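import Summits.QuantumFields.YangMills.Theorems.UnitScaleTiltProp7FrameCorrectedMinusMeanLevel
import Summits.QuantumFields.YangMills.Theorems.UnitScaleTiltProp7TowerClosenessGeometric
import Summits.QuantumFields.YangMills.Theorems.UnitScaleTiltProp7TowerClosenessOfRegPr
import HarnessLib

/-!
# Route `UnitScaleTilt`, crux K1 child «MinimiserStabilityRegPr» (stmt-QuantumFields-19200), skeleton v10, stub `stub_existenceMinimalOrbit` (EX), route (α) —
# **(R2t, FILE B1) THE T³ MEMBER'S PER-LEVEL TOWER DATA FROM `RegPr` AND THE ERROR SEQUENCE `ε_j ≤ δ_T`** (sequel of `…FrameCorrectedMinusMeanLevel`; LOCATE memo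
# `pub/ym3-torus/ym3-torus-px6/LOCATE-R2t-px6g2.md`).

Cell `ym3-torus`, width seat `ym3-torus-px6` (gen 2).  THEOREMS ONLY (0 `def`, 0 `sorry`).  `--supports stmt-QuantumFields-19200 --as helper`, count-neutral.  YM₃ on T³ is a ladder
rung (R3), not the Clay problem; nothing here claims the stub, the crux, d = 4 or the mass gap.

THE POINT.  §6 discharges the DISPLAYED per-level hypotheses of ✓`exists_frameResponse_norm_sub_avgSeq_le` at the T³ member — background `U₀ ∈ 𝔘_k(ε₀)` (`10¹²L³ε₀ ≤ 1`), chart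
point `U′ = e^{A₁}U₀` (`‖A₁‖ < e·η`, `10⁹L²e ≤ 1`) and `U′ ∈ 𝔘_k(ε₀′)` (`10⁷L³ε₀′ ≤ 1`, used ONLY for the `U1`-valuedness of the moving tower `D̄_j = (Ū′⁽ʲ⁾)^{ν_j⁻¹}`): stairs
`δτ_j = 60L·c·(Lʲη)` (✓`norm_tstairU_sub_one_le_geom_of_regPr`), frames `δν_j = 6·(5L)·c·(Lʲη)` (✓`norm_dbarCovIterU_rel_sub_one_le_geom_of_regPr`), `c = 2e + 2700Lε₀`, all units
`SU(2)` hence contractive (✓`frameAccU_bgUnits_mem_specialUnitaryGroup_of_regPr`, ✓`emlIterU_bgUnits_mem_U1_of_regPr`, ✓`holT_mem_U1`).  §7 is the numerics of the error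
sequence `ε_j = 2Σ_{i<j} x_i`, `x_j = (240L + 19560L³)·c·(Lʲη) = 2(2δν_j + δτ_j) + 326·L²·δτ_j` (majorant constant `S = L²`, `L³ ≤ S²`): the geometric sum `Σ_{i<j} Lⁱη ≤ 1∕(L−1)`
and **`ε_j ≤ 2(240L + 19560L³)c∕(L−1)`** =: the closed form of the LETTER `δ_T` (`≤ 3∕10⁴` under the two windows of record — `L`-UNIFORM, no new window — and `≤ 3∕10⁶` under the
tighter `10¹¹L²e ≤ 1`, `10¹⁴L³ε₀ ≤ 1` of the (hS) knit), with the recursion row `ε_j + (1 + ε_j)x_j ≤ ε_{j+1}`.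

WHAT IS PROVED (sorry-free, no definition): §6 `norm_le_one_of_mem_specialUnitaryGroup`, `norm_inv_sub_one_le`, ★`towerData_of_regPr` (the ten rows); §7 `sum_pow_mul_eta_le`, `deltaT_le`,
`deltaT_le_tight`, ★`epsSeq_rows`.
HONEST SCOPE: re-wraps of landed tower lemmas plus explicit arithmetic; `hreg′` enters only through the moving tower's unitarity; nothing of print is asserted.

References: T. Bałaban, CMP 98 (1985) 17–51 [Balaban1985Averaging] ((19) p.21, (58) p.27, (82) p.30, (97) p.32, (161)–(163) p.42); CMP 102 (1985) 277–309 [Balaban1985Variational]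
((2) p.278); CMP 109 (1987) 249–301 [Balaban1987RG1] ((0.3)–(0.4) pp.252–253).
-/

set_option autoImplicit false

noncomputable section

open scoped BigOperators Topology
open Filter NormedSpace Metric
open scoped Matrix.Norms.L2Operator

namespace Summit.QuantumFields.YangMills.Theorems.Prop7FrameCorrectedMinusMean

open Literature.MathematicalPhysics.QuantumFieldTheory.Balaban1983to89
open T4Continuum BlockAveraging ExpMeanLog MatrixLog
open B10Eq27TorusAxialLog (holT gaugeActT gaugeActT_apply transl unitsField toUField)
open B7Prop1Explicit (expUnit val_expUnit disp U1 mem_U1)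
open B7TransferAnalyticMean (meanCLM meanCLM_apply)
open Summit.QuantumFields.YangMills.Theorems.Prop7SymAvgTwSym (tstairU tstairU_def vframeCovU coe_vframeCovU dbarCovIterU frameAccU frameAccU_succ frameAccU_zero
  dbarCovIterU_eq_gaugeActT_frameAccU norm_tstairU_sub_one_le_geom_of_regPr norm_dbarCovIterU_rel_sub_one_le_geom_of_regPr pow_mul_eta_le_one pow_mul_eta_eq_one
  holT_mem_U1 emlIterU_bgUnits_mem_U1_of_regPr)
open Summit.QuantumFields.YangMills.Theorems.Prop7TowerClosenessOfRegPr (frameAccU_bgUnits_mem_specialUnitaryGroup_of_regPr bgUnits_eq_expUnit_mul)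
open Summit.QuantumFields.YangMills.Theorems.Prop8Chart (emlIterU)
open B15DeterminingSets (embIter)
open B5Eq118OneStroke (iterBlockOf iterBlock mem_iterBlock iterBlock_zero sum_iterBlock_succ card_iterBlock)
open T3ContinuumYM3Torus
open T3PrintedRegularMinimiser (RegPr)
open T3SectALandauChart (eta eta_pos bgUnits)
open B7Prop2SpecialUnitary (specialUnitaryUnits mem_specialUnitaryUnits specialUnitaryUnits_le_U1)

/-! ## §6 The T³ member: the displayed per-level data from `RegPr` + the chart window -/

section T3Rows

variable (F : T3Family) {n K : ℕ}

/-- a special unitary unit read in `U1`: `‖u‖ ≤ 1 ∧ ‖u⁻¹‖ ≤ 1`. [cite: Balaban1985Averaging, (19) p.21] -/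
theorem norm_le_one_of_mem_specialUnitaryGroup {u : (Matrix (Fin 2) (Fin 2) ℂ)ˣ} (hu : (u : Matrix (Fin 2) (Fin 2) ℂ) ∈ Matrix.specialUnitaryGroup (Fin 2) ℂ) :
    ‖(u : Matrix (Fin 2) (Fin 2) ℂ)‖ ≤ 1 ∧ ‖((u⁻¹ : (Matrix (Fin 2) (Fin 2) ℂ)ˣ) : Matrix (Fin 2) (Fin 2) ℂ)‖ ≤ 1 := by
  have hsu : u ∈ specialUnitaryUnits (Fin 2) := by rw [mem_specialUnitaryUnits]; exact hu
  exact mem_U1.1 (specialUnitaryUnits_le_U1 hsu)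

/-- the inverse of a contractive unit is as close to `1` as the unit: `‖u⁻¹ − 1‖ ≤ ‖u − 1‖` when `‖u⁻¹‖ ≤ 1`. [folklore] -/
theorem norm_inv_sub_one_le {𝔸 : Type*} [NormedRing 𝔸] (u : 𝔸ˣ) (hu' : ‖((u⁻¹ : 𝔸ˣ) : 𝔸)‖ ≤ 1) :
    ‖((u⁻¹ : 𝔸ˣ) : 𝔸) - 1‖ ≤ ‖(u : 𝔸) - 1‖ := by
  have heq : ((u⁻¹ : 𝔸ˣ) : 𝔸) - 1 = ((u⁻¹ : 𝔸ˣ) : 𝔸) * (1 - (u : 𝔸)) := by rw [mul_sub, mul_one, Units.inv_mul]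
  rw [heq]
  calc _ ≤ ‖((u⁻¹ : 𝔸ˣ) : 𝔸)‖ * ‖1 - (u : 𝔸)‖ := norm_mul_le _ _
    _ ≤ 1 * ‖1 - (u : 𝔸)‖ := by gcongr
    _ = ‖(u : 𝔸) - 1‖ := by rw [one_mul, norm_sub_rev]

/-- ★ **THE PER-LEVEL DATA OF THE R2t INDUCTION AT THE T³ MEMBER, FROM `RegPr` + THE CHART WINDOW.**  For `U₀ ∈ 𝔘_k(ε₀)` (`10¹²L³ε₀ ≤ 1`), `U′ = e^{A₁}U₀ ∈ 𝔘_k(ε₀′)` (`10⁷L³ε₀′ ≤ 1`),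
`‖A₁‖ < e·η` (`10⁹L²e ≤ 1`) and every level `j < K − n`: the stair transporters are within **`δτ_j := 60L·c·(Lʲη)`** of `1` (✓`norm_tstairU_sub_one_le_geom_of_regPr`), the accumulated frames
and their inverses within **`δν_j := 6·(5L)·c·(Lʲη)`** (✓`norm_dbarCovIterU_rel_sub_one_le_geom_of_regPr`), `c := 2e + 2700Lε₀`, and the frames, the one-level frames, the stair holonomies of
the moving tower `D̄_j = (Ū′⁽ʲ⁾)^{ν_j⁻¹}` (✓`dbarCovIterU_eq_gaugeActT_frameAccU`; `Ū′⁽ʲ⁾` is `U1` by ✓`emlIterU_bgUnits_mem_U1_of_regPr` at `U′`) and of the background tower `Ū₀⁽ʲ⁾` are all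
CONTRACTIVE (`SU(2)`: ✓`frameAccU_bgUnits_mem_specialUnitaryGroup_of_regPr`, ✓`holT_mem_U1`). [cite: Balaban1985Averaging, (58) p.27, (82) p.30, (97) p.32, (161)-(163) p.42; Balaban1985Variational, (2) p.278] -/
theorem towerData_of_regPr {ε₀ ε₀' e : ℝ} (hε₀ : 0 < ε₀) (he : 0 < e) (hWe : 10 ^ 9 * (F.L : ℝ) ^ 2 * e ≤ 1) (hWε : 10 ^ 12 * (F.L : ℝ) ^ 3 * ε₀ ≤ 1)
    (hε₀' : 0 < ε₀') (hε' : 10 ^ 7 * (F.L : ℝ) ^ 3 * ε₀' ≤ 1)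
    (U₀ U' : GaugeField (F.P K) 0 (Matrix.specialUnitaryGroup (Fin 2) ℂ)) (hreg : RegPr F n K ε₀ U₀) (hreg' : RegPr F n K ε₀' U')
    (A₁ : PBond (F.P K) 0 → Matrix (Fin 2) (Fin 2) ℂ) (hA₁ : ‖A₁‖ < e * eta F n K)
    (hU' : ∀ b, ((U' b : Matrix.specialUnitaryGroup (Fin 2) ℂ) : Matrix (Fin 2) (Fin 2) ℂ) = exp (A₁ b) * ((U₀ b : Matrix.specialUnitaryGroup (Fin 2) ℂ) : Matrix (Fin 2) (Fin 2) ℂ)) :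
    (∀ (j : ℕ) (y : Site (F.P K) (j + 1)), j < K - n →
        ‖(fun i : Idx (F.P K) => ((tstairU (emlIterU j (bgUnits F K U₀)) (dbarCovIterU j (bgUnits F K U₀) (bgUnits F K U')) y i : (Matrix (Fin 2) (Fin 2) ℂ)ˣ) :
          Matrix (Fin 2) (Fin 2) ℂ)) - 1‖ ≤ 60 * (F.L : ℝ) * ((2 * e + 2700 * (F.L : ℝ) * ε₀) * ((F.L : ℝ) ^ j * eta F n K))) ∧
    (∀ (j : ℕ) (x : Site (F.P K) j), j < K - n → ‖((frameAccU j (bgUnits F K U₀) (bgUnits F K U') x : (Matrix (Fin 2) (Fin 2) ℂ)ˣ) : Matrix (Fin 2) (Fin 2) ℂ)‖ ≤ 1) ∧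
    (∀ (j : ℕ) (x : Site (F.P K) j), j < K - n → ‖(((frameAccU j (bgUnits F K U₀) (bgUnits F K U') x)⁻¹ : (Matrix (Fin 2) (Fin 2) ℂ)ˣ) : Matrix (Fin 2) (Fin 2) ℂ)‖ ≤ 1) ∧
    (∀ (j : ℕ) (x : Site (F.P K) j), j < K - n →
        ‖((frameAccU j (bgUnits F K U₀) (bgUnits F K U') x : (Matrix (Fin 2) (Fin 2) ℂ)ˣ) : Matrix (Fin 2) (Fin 2) ℂ) - 1‖ ≤
          6 * (5 * (F.L : ℝ)) * ((2 * e + 2700 * (F.L : ℝ) * ε₀) * ((F.L : ℝ) ^ j * eta F n K))) ∧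
    (∀ (j : ℕ) (x : Site (F.P K) j), j < K - n →
        ‖(((frameAccU j (bgUnits F K U₀) (bgUnits F K U') x)⁻¹ : (Matrix (Fin 2) (Fin 2) ℂ)ˣ) : Matrix (Fin 2) (Fin 2) ℂ) - 1‖ ≤
          6 * (5 * (F.L : ℝ)) * ((2 * e + 2700 * (F.L : ℝ) * ε₀) * ((F.L : ℝ) ^ j * eta F n K))) ∧
    (∀ (j : ℕ) (y : Site (F.P K) (j + 1)), j < K - n →
        ‖(((vframeCovU (emlIterU j (bgUnits F K U₀)) (dbarCovIterU j (bgUnits F K U₀) (bgUnits F K U')) y)⁻¹ : (Matrix (Fin 2) (Fin 2) ℂ)ˣ) : Matrix (Fin 2) (Fin 2) ℂ)‖ ≤ 1) ∧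
    (∀ (j : ℕ) (y : Site (F.P K) (j + 1)) (i : Idx (F.P K)), j < K - n →
        ‖((holT (dbarCovIterU j (bgUnits F K U₀) (bgUnits F K U')) (emb y) (stairWord i.2.1 (off i.1)) : (Matrix (Fin 2) (Fin 2) ℂ)ˣ) : Matrix (Fin 2) (Fin 2) ℂ)‖ ≤ 1) ∧
    (∀ (j : ℕ) (y : Site (F.P K) (j + 1)) (i : Idx (F.P K)), j < K - n →
        ‖(((holT (dbarCovIterU j (bgUnits F K U₀) (bgUnits F K U')) (emb y) (stairWord i.2.1 (off i.1)))⁻¹ : (Matrix (Fin 2) (Fin 2) ℂ)ˣ) : Matrix (Fin 2) (Fin 2) ℂ)‖ ≤ 1) ∧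
    (∀ (j : ℕ) (y : Site (F.P K) (j + 1)) (i : Idx (F.P K)), j < K - n →
        ‖((holT (emlIterU j (bgUnits F K U₀)) (emb y) (stairWord i.2.1 (off i.1)) : (Matrix (Fin 2) (Fin 2) ℂ)ˣ) : Matrix (Fin 2) (Fin 2) ℂ)‖ ≤ 1) ∧
    (∀ (j : ℕ) (y : Site (F.P K) (j + 1)) (i : Idx (F.P K)), j < K - n →
        ‖(((holT (emlIterU j (bgUnits F K U₀)) (emb y) (stairWord i.2.1 (off i.1)))⁻¹ : (Matrix (Fin 2) (Fin 2) ℂ)ˣ) : Matrix (Fin 2) (Fin 2) ℂ)‖ ≤ 1) := by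
  have hε7 : 10 ^ 7 * (F.L : ℝ) ^ 3 * ε₀ ≤ 1 := by
    have h1 : (0 : ℝ) ≤ (F.L : ℝ) ^ 3 * ε₀ := by positivity
    nlinarith
  have hA₁b : ∀ b, ‖A₁ b‖ ≤ e * eta F n K := fun b => (norm_le_pi_norm A₁ b).trans hA₁.le
  have hW : bgUnits F K U' = fun b => expUnit (A₁ b) * bgUnits F K U₀ b := bgUnits_eq_expUnit_mul F U₀ U' A₁ hU'
  -- frames are special unitary, hence contractive
  have hνsu : ∀ (j : ℕ) (x : Site (F.P K) j), j < K - n →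
      ‖((frameAccU j (bgUnits F K U₀) (bgUnits F K U') x : (Matrix (Fin 2) (Fin 2) ℂ)ˣ) : Matrix (Fin 2) (Fin 2) ℂ)‖ ≤ 1 ∧
      ‖(((frameAccU j (bgUnits F K U₀) (bgUnits F K U') x)⁻¹ : (Matrix (Fin 2) (Fin 2) ℂ)ˣ) : Matrix (Fin 2) (Fin 2) ℂ)‖ ≤ 1 := fun j x hj =>
    norm_le_one_of_mem_specialUnitaryGroup (frameAccU_bgUnits_mem_specialUnitaryGroup_of_regPr F hε₀ he hWe hWε U₀ U' hreg A₁ hA₁ hU' hj.le x)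
  have hνsu' : ∀ (j : ℕ) (x : Site (F.P K) j), j ≤ K - n →
      ‖((frameAccU j (bgUnits F K U₀) (bgUnits F K U') x : (Matrix (Fin 2) (Fin 2) ℂ)ˣ) : Matrix (Fin 2) (Fin 2) ℂ)‖ ≤ 1 ∧
      ‖(((frameAccU j (bgUnits F K U₀) (bgUnits F K U') x)⁻¹ : (Matrix (Fin 2) (Fin 2) ℂ)ˣ) : Matrix (Fin 2) (Fin 2) ℂ)‖ ≤ 1 := fun j x hj =>
    norm_le_one_of_mem_specialUnitaryGroup (frameAccU_bgUnits_mem_specialUnitaryGroup_of_regPr F hε₀ he hWe hWε U₀ U' hreg A₁ hA₁ hU' hj x)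
  -- the two towers are `U1`-valued
  have hQ1 : ∀ (j : ℕ), j < K - n → ∀ b : PBond (F.P K) j, emlIterU j (bgUnits F K U₀) b ∈ U1 (Matrix (Fin 2) (Fin 2) ℂ) := fun j hj b =>
    emlIterU_bgUnits_mem_U1_of_regPr F hε₀ hε7 hreg hj.le b
  have hP1 : ∀ (j : ℕ), j < K - n → ∀ b : PBond (F.P K) j, dbarCovIterU j (bgUnits F K U₀) (bgUnits F K U') b ∈ U1 (Matrix (Fin 2) (Fin 2) ℂ) := by
    intro j hj b
    rw [dbarCovIterU_eq_gaugeActT_frameAccU, gaugeActT_apply]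
    refine (U1 _).mul_mem ((U1 _).mul_mem ?_ (emlIterU_bgUnits_mem_U1_of_regPr F hε₀' hε' hreg' hj.le b)) ?_
    · exact mem_U1.2 ⟨(hνsu j _ hj).2, by rw [inv_inv]; exact (hνsu j _ hj).1⟩
    · rw [inv_inv]; exact mem_U1.2 ⟨(hνsu j _ hj).1, (hνsu j _ hj).2⟩
  refine ⟨fun j y hj => ?_, fun j x hj => (hνsu j x hj).1, fun j x hj => (hνsu j x hj).2, fun j x hj => ?_, fun j x hj => ?_, fun j y hj => ?_,
    fun j y i hj => (mem_U1.1 (holT_mem_U1 (hP1 j hj) _ _)).1, fun j y i hj => (mem_U1.1 (holT_mem_U1 (hP1 j hj) _ _)).2,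
    fun j y i hj => (mem_U1.1 (holT_mem_U1 (hQ1 j hj) _ _)).1, fun j y i hj => (mem_U1.1 (holT_mem_U1 (hQ1 j hj) _ _)).2⟩
  · -- stairs, in the sup norm over `Idx`
    have hη := eta_pos F n K
    refine (pi_norm_le_iff_of_nonneg (by positivity)).2 fun i => ?_
    have h := norm_tstairU_sub_one_le_geom_of_regPr F hε₀ he.le hWe hWε U₀ hreg A₁ hA₁b hj y i
    rw [← hW] at h
    simpa only [Pi.sub_apply, Pi.one_apply] using h
  · -- frames
    have h := (norm_dbarCovIterU_rel_sub_one_le_geom_of_regPr F hε₀ he.le hWe hWε U₀ hreg A₁ hA₁b hj.le (⟨x, ⟨0, (F.P K).hd⟩⟩ : PBond (F.P K) j)).2.1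
    rw [← hW] at h
    exact h
  · -- inverse frames
    have h := (norm_dbarCovIterU_rel_sub_one_le_geom_of_regPr F hε₀ he.le hWe hWε U₀ hreg A₁ hA₁b hj.le (⟨x, ⟨0, (F.P K).hd⟩⟩ : PBond (F.P K) j)).2.1
    rw [← hW] at h
    exact (norm_inv_sub_one_le _ (hνsu j x hj).2).trans h
  · -- one-level frames: `w_j(y) = ν_j(ŷ)⁻¹·ν_{j+1}(y)`
    have hsucc : vframeCovU (emlIterU j (bgUnits F K U₀)) (dbarCovIterU j (bgUnits F K U₀) (bgUnits F K U')) y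
        = (frameAccU j (bgUnits F K U₀) (bgUnits F K U') (emb y))⁻¹ * frameAccU (j + 1) (bgUnits F K U₀) (bgUnits F K U') y := by
      rw [frameAccU_succ, inv_mul_cancel_left]
    rw [hsucc, mul_inv_rev, inv_inv, Units.val_mul]
    have h1 := (hνsu' (j + 1) y (by omega)).2
    have h2 := (hνsu j (emb y) hj).1
    calc _ ≤ ‖(((frameAccU (j + 1) (bgUnits F K U₀) (bgUnits F K U') y)⁻¹ : (Matrix (Fin 2) (Fin 2) ℂ)ˣ) : Matrix (Fin 2) (Fin 2) ℂ)‖ *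
          ‖((frameAccU j (bgUnits F K U₀) (bgUnits F K U') (emb y) : (Matrix (Fin 2) (Fin 2) ℂ)ˣ) : Matrix (Fin 2) (Fin 2) ℂ)‖ := norm_mul_le _ _
      _ ≤ 1 * 1 := by gcongr
      _ = 1 := one_mul 1

end T3Rows


/-! ## §7 The error sequence `ε_j` at T³ and its numerical bound under the two windows -/

section Numerics

variable (F : T3Family) {n K : ℕ}

/-- the level factors sum geometrically: `Σ_{i<j} Lⁱη ≤ 1∕(L − 1)` for `j ≤ K − n` (`L^{K−n}·η = 1`, ✓`pow_mul_eta_le_one`). [cite: Balaban1985Averaging, (161)-(163) p.42] -/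
theorem sum_pow_mul_eta_le {j : ℕ} (hj : j ≤ K - n) :
    ∑ i ∈ Finset.range j, (F.L : ℝ) ^ i * eta F n K ≤ 1 / ((F.L : ℝ) - 1) := by
  have hL3 : 3 ≤ F.L := by obtain ⟨a, ha⟩ := F.hL.1; have := F.hL.2; omega
  have hL3r : (3 : ℝ) ≤ F.L := by exact_mod_cast hL3
  have hL1 : (0 : ℝ) < (F.L : ℝ) - 1 := by linarith
  have hη : 0 < eta F n K := eta_pos F n K
  have hgeom : (∑ i ∈ Finset.range j, (F.L : ℝ) ^ i) * ((F.L : ℝ) - 1) = (F.L : ℝ) ^ j - 1 := geom_sum_mul _ _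
  have hXj : (F.L : ℝ) ^ j * eta F n K ≤ 1 := pow_mul_eta_le_one F hj
  rw [← Finset.sum_mul, le_div_iff₀ hL1]
  calc (∑ i ∈ Finset.range j, (F.L : ℝ) ^ i) * eta F n K * ((F.L : ℝ) - 1)
      = ((F.L : ℝ) ^ j - 1) * eta F n K := by rw [mul_right_comm, hgeom]
    _ ≤ (F.L : ℝ) ^ j * eta F n K := by nlinarith
    _ ≤ 1 := hXj

/-- **THE R2t LETTER `δ_T` UNDER THE TWO WINDOWS OF RECORD**: with `c = 2e + 2700Lε₀`, `10⁹L²e ≤ 1`, `10¹²L³ε₀ ≤ 1`, `L ≥ 3`: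
`2·(240L + 19560L³)·c∕(L − 1) ≤ 3∕10⁴` — discharges the displayed `hδT` of FILE B2 at `δT := 3∕10⁴`, `L`-uniformly. [cite: Balaban1985Variational, (2) p.278; Balaban1985Averaging, (161)-(163) p.42] -/
theorem deltaT_le {ε₀ e : ℝ} (hε₀ : 0 < ε₀) (he : 0 ≤ e) (hWe : 10 ^ 9 * (F.L : ℝ) ^ 2 * e ≤ 1) (hWε : 10 ^ 12 * (F.L : ℝ) ^ 3 * ε₀ ≤ 1) :
    2 * (240 * (F.L : ℝ) + 19560 * (F.L : ℝ) ^ 3) * (2 * e + 2700 * (F.L : ℝ) * ε₀) / ((F.L : ℝ) - 1) ≤ 3 / 10 ^ 4 := by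
  have hL3 : 3 ≤ F.L := by obtain ⟨a, ha⟩ := F.hL.1; have := F.hL.2; omega
  have hL3r : (3 : ℝ) ≤ F.L := by exact_mod_cast hL3
  have hL1 : (0 : ℝ) < (F.L : ℝ) - 1 := by linarith
  rw [div_le_iff₀ hL1]
  -- the four monomials: `Le ≤ 10⁻⁹∕(3L⁰)`-type bounds
  have hu : (F.L : ℝ) ^ 2 * e ≤ 1 / 10 ^ 9 := by rw [le_div_iff₀ (by positivity)]; linarith
  have hv : (F.L : ℝ) ^ 3 * ε₀ ≤ 1 / 10 ^ 12 := by rw [le_div_iff₀ (by positivity)]; linarith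
  have h1 : (F.L : ℝ) * e ≤ 1 / 10 ^ 9 / 3 := by
    have : 3 * ((F.L : ℝ) * e) ≤ (F.L : ℝ) ^ 2 * e := by
      calc 3 * ((F.L : ℝ) * e) ≤ (F.L : ℝ) * ((F.L : ℝ) * e) := mul_le_mul_of_nonneg_right hL3r (by positivity)
        _ = (F.L : ℝ) ^ 2 * e := by ring
    linarith
  have h2 : (F.L : ℝ) ^ 2 * ε₀ ≤ 1 / 10 ^ 12 / 3 := by
    have : 3 * ((F.L : ℝ) ^ 2 * ε₀) ≤ (F.L : ℝ) ^ 3 * ε₀ := by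
      calc 3 * ((F.L : ℝ) ^ 2 * ε₀) ≤ (F.L : ℝ) * ((F.L : ℝ) ^ 2 * ε₀) := mul_le_mul_of_nonneg_right hL3r (by positivity)
        _ = (F.L : ℝ) ^ 3 * ε₀ := by ring
    linarith
  have h3 : (F.L : ℝ) ^ 3 * e ≤ (F.L : ℝ) * (1 / 10 ^ 9) := by
    have : (F.L : ℝ) ^ 3 * e = (F.L : ℝ) * ((F.L : ℝ) ^ 2 * e) := by ring
    rw [this]; exact mul_le_mul_of_nonneg_left hu (by positivity)
  have h4 : (F.L : ℝ) ^ 4 * ε₀ ≤ (F.L : ℝ) * (1 / 10 ^ 12) := by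
    have : (F.L : ℝ) ^ 4 * ε₀ = (F.L : ℝ) * ((F.L : ℝ) ^ 3 * ε₀) := by ring
    rw [this]; exact mul_le_mul_of_nonneg_left hv (by positivity)
  have hexp : 2 * (240 * (F.L : ℝ) + 19560 * (F.L : ℝ) ^ 3) * (2 * e + 2700 * (F.L : ℝ) * ε₀)
      = 960 * ((F.L : ℝ) * e) + 1296000 * ((F.L : ℝ) ^ 2 * ε₀) + 78240 * ((F.L : ℝ) ^ 3 * e) + 105624000 * ((F.L : ℝ) ^ 4 * ε₀) := by ring
  rw [hexp]
  nlinarith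


/-- **THE SAME LETTER UNDER THE TIGHTER WINDOWS OF THE (hS) KNIT** (★w5-20520 g7 19:57:37Z∕20:13:56Z): with `10¹¹L²e ≤ 1`, `10¹⁴L³ε₀ ≤ 1`, `L ≥ 3`:
`2·(240L + 19560L³)·c∕(L − 1) ≤ 3∕10⁶`. [cite: Balaban1985Variational, (2) p.278; Balaban1985Averaging, (161)-(163) p.42] -/
theorem deltaT_le_tight {ε₀ e : ℝ} (hε₀ : 0 < ε₀) (he : 0 ≤ e) (hWe : 10 ^ 11 * (F.L : ℝ) ^ 2 * e ≤ 1) (hWε : 10 ^ 14 * (F.L : ℝ) ^ 3 * ε₀ ≤ 1) :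
    2 * (240 * (F.L : ℝ) + 19560 * (F.L : ℝ) ^ 3) * (2 * e + 2700 * (F.L : ℝ) * ε₀) / ((F.L : ℝ) - 1) ≤ 3 / 10 ^ 6 := by
  have hL3 : 3 ≤ F.L := by obtain ⟨a, ha⟩ := F.hL.1; have := F.hL.2; omega
  have hL3r : (3 : ℝ) ≤ F.L := by exact_mod_cast hL3
  have hL1 : (0 : ℝ) < (F.L : ℝ) - 1 := by linarith
  rw [div_le_iff₀ hL1]
  have hu : (F.L : ℝ) ^ 2 * e ≤ 1 / 10 ^ 11 := by rw [le_div_iff₀ (by positivity)]; linarith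
  have hv : (F.L : ℝ) ^ 3 * ε₀ ≤ 1 / 10 ^ 14 := by rw [le_div_iff₀ (by positivity)]; linarith
  have h1 : (F.L : ℝ) * e ≤ 1 / 10 ^ 11 / 3 := by
    have : 3 * ((F.L : ℝ) * e) ≤ (F.L : ℝ) ^ 2 * e := by
      calc 3 * ((F.L : ℝ) * e) ≤ (F.L : ℝ) * ((F.L : ℝ) * e) := mul_le_mul_of_nonneg_right hL3r (by positivity)
        _ = (F.L : ℝ) ^ 2 * e := by ring
    linarith
  have h2 : (F.L : ℝ) ^ 2 * ε₀ ≤ 1 / 10 ^ 14 / 3 := by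
    have : 3 * ((F.L : ℝ) ^ 2 * ε₀) ≤ (F.L : ℝ) ^ 3 * ε₀ := by
      calc 3 * ((F.L : ℝ) ^ 2 * ε₀) ≤ (F.L : ℝ) * ((F.L : ℝ) ^ 2 * ε₀) := mul_le_mul_of_nonneg_right hL3r (by positivity)
        _ = (F.L : ℝ) ^ 3 * ε₀ := by ring
    linarith
  have h3 : (F.L : ℝ) ^ 3 * e ≤ (F.L : ℝ) * (1 / 10 ^ 11) := by
    have : (F.L : ℝ) ^ 3 * e = (F.L : ℝ) * ((F.L : ℝ) ^ 2 * e) := by ring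
    rw [this]; exact mul_le_mul_of_nonneg_left hu (by positivity)
  have h4 : (F.L : ℝ) ^ 4 * ε₀ ≤ (F.L : ℝ) * (1 / 10 ^ 14) := by
    have : (F.L : ℝ) ^ 4 * ε₀ = (F.L : ℝ) * ((F.L : ℝ) ^ 3 * ε₀) := by ring
    rw [this]; exact mul_le_mul_of_nonneg_left hv (by positivity)
  have hexp : 2 * (240 * (F.L : ℝ) + 19560 * (F.L : ℝ) ^ 3) * (2 * e + 2700 * (F.L : ℝ) * ε₀)
      = 960 * ((F.L : ℝ) * e) + 1296000 * ((F.L : ℝ) ^ 2 * ε₀) + 78240 * ((F.L : ℝ) ^ 3 * e) + 105624000 * ((F.L : ℝ) ^ 4 * ε₀) := by ring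
  rw [hexp]
  nlinarith

/-- ★ **THE ERROR SEQUENCE OF THE R2t INDUCTION AT T³** — `x_j := (240L + 19560L³)·c·(Lʲη)` (`= 2(2δν_j + δτ_j) + 326·L²·δτ_j`), `ε_j := 2Σ_{i<j} x_i`: for `j ≤ K − n`,
`0 ≤ ε_j ≤ 2·(240L + 19560L³)·c∕(L − 1)` (the LETTER `δ_T`'s closed form; `≤ 3∕10⁴` by `deltaT_le`), and the recursion row `ε_j + (1 + ε_j)·x_j ≤ ε_{j+1}` (since `ε_j ≤ 1`). [cite: Balaban1985Averaging, (161)-(163) p.42; Balaban1985Variational, (2) p.278] -/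
theorem epsSeq_rows {ε₀ e : ℝ} (hε₀ : 0 < ε₀) (he : 0 ≤ e) (hWe : 10 ^ 9 * (F.L : ℝ) ^ 2 * e ≤ 1) (hWε : 10 ^ 12 * (F.L : ℝ) ^ 3 * ε₀ ≤ 1) :
    (∀ j, 0 ≤ 2 * ∑ i ∈ Finset.range j, (240 * (F.L : ℝ) + 19560 * (F.L : ℝ) ^ 3) * ((2 * e + 2700 * (F.L : ℝ) * ε₀) * ((F.L : ℝ) ^ i * eta F n K))) ∧
    (∀ j, j ≤ K - n → 2 * ∑ i ∈ Finset.range j, (240 * (F.L : ℝ) + 19560 * (F.L : ℝ) ^ 3) * ((2 * e + 2700 * (F.L : ℝ) * ε₀) * ((F.L : ℝ) ^ i * eta F n K))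
      ≤ 2 * (240 * (F.L : ℝ) + 19560 * (F.L : ℝ) ^ 3) * (2 * e + 2700 * (F.L : ℝ) * ε₀) / ((F.L : ℝ) - 1)) ∧
    (∀ j, j < K - n →
      2 * ∑ i ∈ Finset.range j, (240 * (F.L : ℝ) + 19560 * (F.L : ℝ) ^ 3) * ((2 * e + 2700 * (F.L : ℝ) * ε₀) * ((F.L : ℝ) ^ i * eta F n K))
        + (1 + 2 * ∑ i ∈ Finset.range j, (240 * (F.L : ℝ) + 19560 * (F.L : ℝ) ^ 3) * ((2 * e + 2700 * (F.L : ℝ) * ε₀) * ((F.L : ℝ) ^ i * eta F n K))) *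
          (2 * (2 * (6 * (5 * (F.L : ℝ)) * ((2 * e + 2700 * (F.L : ℝ) * ε₀) * ((F.L : ℝ) ^ j * eta F n K))) + 60 * (F.L : ℝ) * ((2 * e + 2700 * (F.L : ℝ) * ε₀) * ((F.L : ℝ) ^ j * eta F n K)))
            + 326 * (F.L : ℝ) ^ 2 * (60 * (F.L : ℝ) * ((2 * e + 2700 * (F.L : ℝ) * ε₀) * ((F.L : ℝ) ^ j * eta F n K))))
      ≤ 2 * ∑ i ∈ Finset.range (j + 1), (240 * (F.L : ℝ) + 19560 * (F.L : ℝ) ^ 3) * ((2 * e + 2700 * (F.L : ℝ) * ε₀) * ((F.L : ℝ) ^ i * eta F n K))) := by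
  have hL3 : 3 ≤ F.L := by obtain ⟨a, ha⟩ := F.hL.1; have := F.hL.2; omega
  have hL3r : (3 : ℝ) ≤ F.L := by exact_mod_cast hL3
  have hη : 0 < eta F n K := eta_pos F n K
  set κ : ℝ := (240 * (F.L : ℝ) + 19560 * (F.L : ℝ) ^ 3) * (2 * e + 2700 * (F.L : ℝ) * ε₀) with hκ
  have hκ0 : 0 ≤ κ := by positivity
  have hx : ∀ i, (240 * (F.L : ℝ) + 19560 * (F.L : ℝ) ^ 3) * ((2 * e + 2700 * (F.L : ℝ) * ε₀) * ((F.L : ℝ) ^ i * eta F n K)) = κ * ((F.L : ℝ) ^ i * eta F n K) := by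
    intro i; rw [hκ]; ring
  have hx0 : ∀ i, 0 ≤ κ * ((F.L : ℝ) ^ i * eta F n K) := fun i => by positivity
  simp only [hx]
  have hsum : ∀ j, j ≤ K - n → 2 * ∑ i ∈ Finset.range j, κ * ((F.L : ℝ) ^ i * eta F n K)
      ≤ 2 * (240 * (F.L : ℝ) + 19560 * (F.L : ℝ) ^ 3) * (2 * e + 2700 * (F.L : ℝ) * ε₀) / ((F.L : ℝ) - 1) := by
    intro j hj
    rw [← Finset.mul_sum]
    calc 2 * (κ * ∑ i ∈ Finset.range j, (F.L : ℝ) ^ i * eta F n K) ≤ 2 * (κ * (1 / ((F.L : ℝ) - 1))) := by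
          have := sum_pow_mul_eta_le F hj
          gcongr
      _ = 2 * (240 * (F.L : ℝ) + 19560 * (F.L : ℝ) ^ 3) * (2 * e + 2700 * (F.L : ℝ) * ε₀) / ((F.L : ℝ) - 1) := by rw [hκ]; ring
  refine ⟨fun j => mul_nonneg two_pos.le (Finset.sum_nonneg fun i _ => hx0 i), hsum, fun j hj => ?_⟩
  -- the recursion row: `ε_{j+1} − ε_j = 2x_j ≥ (1 + ε_j)x_j` because `ε_j ≤ 1`
  have hεj1 : 2 * ∑ i ∈ Finset.range j, κ * ((F.L : ℝ) ^ i * eta F n K) ≤ 1 :=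
    (hsum j hj.le).trans ((deltaT_le F hε₀ he hWe hWε).trans (by norm_num))
  have hxj : 2 * (2 * (6 * (5 * (F.L : ℝ)) * ((2 * e + 2700 * (F.L : ℝ) * ε₀) * ((F.L : ℝ) ^ j * eta F n K))) + 60 * (F.L : ℝ) * ((2 * e + 2700 * (F.L : ℝ) * ε₀) * ((F.L : ℝ) ^ j * eta F n K)))
      + 326 * (F.L : ℝ) ^ 2 * (60 * (F.L : ℝ) * ((2 * e + 2700 * (F.L : ℝ) * ε₀) * ((F.L : ℝ) ^ j * eta F n K))) = κ * ((F.L : ℝ) ^ j * eta F n K) := by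
    rw [hκ]; ring
  rw [hxj, Finset.sum_range_succ, mul_add]
  have hxj0 := hx0 j
  nlinarith

end Numerics


end Summit.QuantumFields.YangMills.Theorems.Prop7FrameCorrectedMinusMean

end
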